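import Summits.QuantumFields.YangMills.Theses.PencilRigidity

/-!
# Line `axis-extremal-collapse` — skeleton for crux `PencilRigidity.CurvatureKernelBound`
(item stmt-QuantumFields-11687, route route-QuantumFields-PencilRigidity)

crux-plan round 1 · planner-cruxplan-stmt-QuantumFields-11687-axis-extremal-collap-0 · idea card
`Cruxes/CurvatureKernelBound/Ideas/axis-extremal-collapse.md` (triage r1: pass ×3, merged with
`window-ratio-ir-free-transfer`; sharpenings G1/G2/G3 of r1-1, F4/F5 of r1-2, r1-3 applied) · line card
`Lines/axis-extremal-collapse.md` · `lean check` rc 0, sorries only in the six `stub_*`.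

THE CRUX (as filed): for every compact simple `G`, `r`, `sch` and one-species family `S₁` with the
curvature package `W₁ r sch S₁` there is a REAL kernel `K`, continuous on `ℝ⁴ ∖ 0`, with
`|K x| ≤ C (1 + ‖x‖^(η-10))`, `η > 0`, representing `S₁ 2` on `⁰𝒮`.

THE LINE. Reflection positivity makes the TIME AXIS EXTREMAL: 2×2 minors of the OS form dominate every
off-axis value of a two-point kernel by axial ones (`|K ξ| ≤ K(|ξ_μ| e₀)`), and the same Cauchy–Schwarz
in Wilson's lattice theory (site/link reflections of the odd torus, `TorusOddRP`) dominates the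
curvature–curvature correlator at lattice shift `z` by AXIAL correlators at separation `‖z‖_∞` of
finitely many mirror-corner variants of the action density (`stub_latticeAxisDomination`, provable now).
So the four-dimensional kernel statement collapses to
(order)      ONE calibrated inequality on axial lattice correlators across the UV window, at PHYSICAL
             scales `≥ ρ_k → 0` (`stub_uvWindowMajorant`, OPEN — the residual crux of the line), plus
(function)   a weak-* / Riemann-sum passage from k-uniformly dominated lattice kernels to a measurable,
             bounded kernel representing `S₁ 2` on `⁰𝒮` (`stub_dominatedLatticeKernel`, provable now), plus
(regularity) Bochner–Schwartz on the four axis charts: a measurable locally bounded kernel representing an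
             RP, translation- and W(B₄)∩SO(4)-invariant two-point function IS continuous off 0
             (`stub_axisChartContinuity`, provable now, engine `OSReconstructionNoE1` +
             `exists_isJointSpectralMeasure_holds`),
after the scheme has been sorted (`stub_schemeDichotomy`, OPEN conjecture: a non-degenerate Wilson
continuum limit lives at infinite |coupling|) and the degenerate/ultralocal branch dispatched
(`stub_degenerateKernel`, provable now; ends in cdisprove's `kernelConclusion_of_const`).

    CurvatureKernelBound ⇐  em (Degenerate S₁)
      · Degenerate    : stub_degenerateKernel                                   (K ≡ s², η = 10)
      · ¬Degenerate   : stub_schemeDichotomy ⇒ |β_k| → ∞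
                        stub_uvWindowMajorant ⇒ ∀ᶠ k: (β_k ≥ 0 ⇒ axial majorant on the finite family 𝓕)
                                                     ∧ (β_k < 0 ⇒ all-direction majorant)
                        stub_latticeAxisDomination (β_k ≥ 0, family 𝓕(r)) ⇒ all-direction majorant
                        stub_dominatedLatticeKernel ⇒ measurable bounded representing kernel
                        stub_axisChartContinuity ⇒ continuous representative  = the crux's conclusion.

`CurvatureKernelBound_of` is this composition, sorry-free, over the six stub STATEMENTS (`type_of%`),
concluding `Summit.QuantumFields.YangMills.Theses.PencilRigidity.CurvatureKernelBound` by name;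
`CurvatureKernelBound_of_stubs` applies it to the sorried stubs (so the audit lists exactly the six
sorries the crux depends on along this line).

DEGENERATE := the truncated two-point function of `S₁` vanishes on real off-diagonal tensors
(`S₁ 2 (f ⊗ g) = S₁ 1 f · S₁ 1 g`, witnesses quantified). Inhabitants: the zero scheme (K = 0), every
constant-field / ultralocal limit (K = κ²), every scheme with `β_k = 0` infinitely often (cdisprove v2
`W1_twoPoint_eq_mul_of_beta_zero`), the triage inhabitant G2 (β_k ≡ β₀ small, c_k = a_k⁻⁵).

DISPROOF USED (cdisprove v1–v3, evidence 20260815T225720Z-Disproof.lean; read through its evidence notes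
— `run/gate/evidence` is not mounted in planner jails and `Cruxes/…/Disproof.lean` is not yet
crux-written): no `_false_without_` theorem and no `Theorems/CurvatureKernelBound/Negative/` lemma has
landed (nothing to import; `ledger negatives --problem QuantumFields`: none related). Honoured:
(i) `kernelConclusion_of_const/_of_vanishing` — the last step of `stub_degenerateKernel`;
(ii) the near-miss `¬CurvatureKernelBoundWithoutLattice` (ψ = (Σ∂_μ⁴)φ_m at |x|⁻¹⁰) and rattack's
mutation (App. C: the S₁-side package alone carries no kernel regularity) — the LATTICE clause of W₁ is
used in `stub_uvWindowMajorant` (lattice correlators), `stub_dominatedLatticeKernel` (convergence pins the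
kernel), `stub_degenerateKernel` (reality of the one-point constant), `stub_schemeDichotomy`; the only
model-blind stub, `stub_axisChartContinuity`, ASSUMES a locally bounded representing kernel, which the
mutation witness Σ_μ δ³(x⊥_μ)e^{-m|x_μ|} lacks (needles have M ≡ ∞), so it does not claim what the
near-miss refutes; (iii) §4 β ≡ 0 ultralocality — such schemes are Degenerate, consistent with
`stub_schemeDichotomy` (β_k = 0 i.o. ⇒ ¬(|β_k| → ∞) ⇒ the stub demands Degenerate, which cdisprove PROVES
there); (iv) §5 pinning (`kernel_unique`, `bound_of_represents_of_kernelData`) — `stub_dominatedLatticeKernel`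
+ `stub_axisChartContinuity` construct THE physical kernel, on which the bound is a property, as §5 says.
TRIAGE: G1 (reality only from the lattice) — no stub derives reality model-blindly; G2 (no lattice bound
at fixed lattice distance with the scheme's c_k) — every lattice inequality is at physical scales
`a_k n ≥ ρ_k`, `ρ_k → 0`, and only in the branch ¬Degenerate ∧ |β_k| → ∞ (G2 is Degenerate); the
c_k-free ratio/doubling forms (D_p)/H_ratio are NOT used as stubs because they are false in the ultralocal
branch at physical scales (r1-1) — the calibrated majorant is the all-branch-true currency; F5 / the scheme
trichotomy is `stub_schemeDichotomy`; "keep the calibration a named step" (r1-2) — it is clause (b) of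
`stub_uvWindowMajorant`'s docstring, inside the one open stub, because calibration at one physical scale
and the window bound are the same Bałaban-with-one-observable statement at its two ends.
-/

namespace Summit.QuantumFields.YangMills.Cruxes.CurvatureKernelBound.AxisExtremalCollapse

open scoped BigOperators Topology Classical MeasureTheory Matrix InnerProductSpace ComplexConjugate
open Filter Set Function TopologicalSpace MeasureTheory
open Literature.MathematicalPhysics.QuantumLattice Literature.MathematicalPhysics.AQFT
  Literature.MathematicalPhysics.QuantumFieldTheory

/-! ## Registered stubs (6)

Conventions shared by the statements (all inlined, exactly as the route file inlines `W₁`):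
`W₁ r sch S₁` is copied VERBATIM from `PencilRigidity.CurvatureKernelBound`; `Degenerate S₁` is the
displayed clause `∀ f g F F₁ G₁, IsTensorOf F ![f,g] → IsOffDiagonal F → … → S₁ 2 F = S₁ 1 F₁ * S₁ 1 G₁`
(real `f g`); the general-shift connected curvature correlator on the scheme's odd torus is written out as
`(∫ P(Ũ) · P(configShift (-z) Ũ) dμ_k) − (∫ P Ũ dμ_k)(∫ P Ũ dμ_k)`, `P = r.curvature.F`,
`μ_k = wilsonMeasure (side 2L_k+1) r.ρ β_k`, `Ũ = torusLift _ U` — for `z = n e₀` this is literally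
`latticeConnectedCorr r.ρ β_k (2L_k+1) P P n`, the vocabulary of `HasLatticeMassGap`; "`n = ‖z‖_∞`" is
the pair of clauses `(∀ i, (z i).natAbs ≤ n) ∧ (∃ i, (z i).natAbs = n)`. -/

/-- **stub_schemeDichotomy** (T) — OPEN (conjecture-grade; "no finite-coupling non-degenerate continuum
limit of Wilson's action"). For every W₁-inhabitant: EITHER the curvature channel is Degenerate (truncated
two-point function ≡ 0 on real off-diagonal tensors), OR `|β_k| → ∞`.
Why plausible: if `|β_k| ≤ B` along a subsequence, the lattice theory there is believed massive at the
LATTICE scale with correlation length locally bounded in β (strong coupling: `osterwalderSeiler_clustering`;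
in general the local-boundedness form of the conjecture `LatticeMassGapAllCouplings`; bulk transitions of
fundamental Wilson actions are first order), so `ξ(β_k) a_k → 0` and the sub-limit — which IS `S₁`, the full
sequence converging by W₁ — is ultralocal on `⁰𝒮` (barrier `FixedCouplingUltralocality_holds` mechanism;
rattack App. B), i.e. Degenerate. The absolute value is essential: for `(G, r)` with `-1 ∈ ρ(Z(G))`
(SU(2), SU(2n), Sp(n) fundamental, …) the centre-flux map `U ↦ uU` makes `β ↦ -β` a symmetry up to
't Hooft twists, so non-degenerate schemes with `β_k → -∞` or with oscillating sign exist exactly when the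
usual ones do. Why it might fail: a faithful REDUCIBLE `r` turns Wilson's action into a mixed
fundamental–adjoint action on one ray of the Bhanot–Creutz plane; a ray through the second-order endpoint
of the first-order bulk line would carry a finite-β critical point whose massive scaling limit (a
generalised free field for the plaquette) could inhabit W₁ non-degenerately. Size: open-problem (as a
theorem); the crux itself survives that scenario (dimension-1 kernel ≍ |x|⁻²), the LINE does not reach it.
Leans on: `HasLatticeMassGap`, `latticeSchwinger` (W₁), `FixedCouplingUltralocality_holds`,
`osterwalderSeiler_clustering`, `LatticeMassGapAllCouplings` (@[conjecture], by name only). -/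
theorem stub_schemeDichotomy :
    let E := EuclideanSpace ℝ (Fin 4); ∀ (G : Type) [Group G] [TopologicalSpace G] [IsTopologicalGroup G] [CompactSpace G], IsCompactSimpleLieGroup G → letI : MeasurableSpace G := borel G; haveI : BorelSpace G := ⟨rfl⟩; let W₁ := fun (r : LatticeRep G) (sch : SpeciesScheme (YMSpecies G)) (S₁ : SchwingerFamily E) => ((∀ (n : ℕ), n ≠ 0 → ∀ (f : Fin n → SchwartzMap (E) ℝ) (F : SchwartzMap (Fin n → E) ℂ), IsTensorOf F (fun i => ofRealTest (f i)) → IsOffDiagonal F → Filter.Tendsto (fun k : ℕ => ((latticeSchwinger r.ρ sch (fun s => s.F) k n (fun _ => r.curvature) f : ℝ) : ℂ)) Filter.atTop (nhds (S₁ n F))) ∧ (S₁.toLabelled.IsNormalized ∧ S₁.toLabelled.IsHermitian ∧ S₁.toLabelled.HasLinearGrowth ∧ S₁.toLabelled.IsReflectionPositive ∧ S₁.toLabelled.IsSymmetric ∧ S₁.toLabelled.HasClusterProperty) ∧ (∀ (n : ℕ) (a : E) (F : SchwartzMap (Fin n → E) ℂ), IsOffDiagonal F → S₁ n (translateMulti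 a F) = S₁ n F) ∧ (∀ (R : E ≃ₗᵢ[ℝ] E), LinearMap.det (R.toLinearEquiv : E →ₗ[ℝ] E) = 1 → (∀ i : Fin 4, ∃ j : Fin 4, R (EuclideanSpace.single i 1) = EuclideanSpace.single j 1 ∨ R (EuclideanSpace.single i 1) = -EuclideanSpace.single j 1) → ∀ (n : ℕ) (F : SchwartzMap (Fin n → E) ℂ), IsOffDiagonal F → S₁ n (linActMulti R F) = S₁ n F) ∧ (∃ Δ : ℝ, 0 < Δ ∧ S₁.toLabelled.HasMassGap Δ ∧ HasLatticeMassGap r sch Δ)); ∀ (r : LatticeRep G) (sch : SpeciesScheme (YMSpecies G)) (S₁ : SchwingerFamily E), W₁ r sch S₁ →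
      (∀ (f g : SchwartzMap E ℝ) (F : SchwartzMap (Fin 2 → E) ℂ) (F₁ G₁ : SchwartzMap (Fin 1 → E) ℂ), IsTensorOf F ![ofRealTest f, ofRealTest g] → IsOffDiagonal F → IsTensorOf F₁ ![ofRealTest f] → IsTensorOf G₁ ![ofRealTest g] → S₁ 2 F = S₁ 1 F₁ * S₁ 1 G₁) ∨
      Filter.Tendsto (fun k : ℕ => |sch.β k|) Filter.atTop Filter.atTop := by
  sorry

/-- **stub_degenerateKernel** (Z) — the degenerate / ultralocal branch, PROVABLE NOW (size M).
If the truncated curvature two-point function vanishes on real off-diagonal tensors then the crux's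
conclusion holds with the CONSTANT kernel `K ≡ s²`, `C = s²`, `η = 10`, where `S₁ 1 F₁ = s ∫ F₁`.
Proof plan: (a) `S₁ 1` is translation invariant on `⁰𝒮` (W₁ clause 3 at `n = 1`; `coincidenceLocus 1 E = ∅`
so every one-point test function is off-diagonal) hence `S₁ 1 = s · ∫` (a translation-invariant tempered
distribution is a constant: it kills `∂_i φ`, and zero-integral Schwartz functions are sums of derivatives);
(b) `s ∈ ℝ` because `S₁ 1 (ofRealTest f)` is a limit of REAL lattice one-point functions (W₁ clause 1,
`n = 1` — this is where reality comes from, triage G1); (c) so `S₁ 2 F = s² ∫ F` on real off-diagonal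
tensors, hence on their complex span, hence on all of `⁰𝒮(E²)` by density of disjointly supported tensors
in `⁰𝒮` for the Schwartz topology (cut-off `1 - χ(|x₀-x₁|/δ)` costs `O(δ^∞)` in every seminorm by
flatness on the diagonal; then `SchwartzTensorDensity` / `SchwartzNuclearExpansion` off the diagonal —
rattack App. A) and continuity of `S₁ 2`; (d) finish with cdisprove's PROVED
`kernelConclusion_of_const` (Disproof.lean v1: `S₁ 2 = κ ∫` on `⁰𝒮` ⇒ conclusion with `K ≡ κ`; needs
`Measure.IsAddHaarMeasure.instHasTemperateGrowth` on `Fin 2 → E` for `SchwartzMap.integrable`).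
Leans on: `translateMulti`, `IsOffDiagonal`, `IsTensorOf`, `ofRealTest`, `SchwartzMap.integrable`,
cdisprove `kernelConclusion_of_const` (evidence Disproof.lean, to be re-proved or imported once landed). -/
theorem stub_degenerateKernel :
    let E := EuclideanSpace ℝ (Fin 4); ∀ (G : Type) [Group G] [TopologicalSpace G] [IsTopologicalGroup G] [CompactSpace G], IsCompactSimpleLieGroup G → letI : MeasurableSpace G := borel G; haveI : BorelSpace G := ⟨rfl⟩; let W₁ := fun (r : LatticeRep G) (sch : SpeciesScheme (YMSpecies G)) (S₁ : SchwingerFamily E) => ((∀ (n : ℕ), n ≠ 0 → ∀ (f : Fin n → SchwartzMap (E) ℝ) (F : SchwartzMap (Fin n → E) ℂ), IsTensorOf F (fun i => ofRealTest (f i)) → IsOffDiagonal F → Filter.Tendsto (fun k : ℕ => ((latticeSchwinger r.ρ sch (fun s => s.F) k n (fun _ => r.curvature) f : ℝ) : ℂ)) Filter.atTop (nhds (S₁ n F))) ∧ (S₁.toLabelled.IsNormalized ∧ S₁.toLabelled.IsHermitian ∧ S₁.toLabelled.HasLinearGrowth ∧ S₁.toLabelled.IsReflectionPositive ∧ S₁.toLabelled.IsSymmetric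 ∧ S₁.toLabelled.HasClusterProperty) ∧ (∀ (n : ℕ) (a : E) (F : SchwartzMap (Fin n → E) ℂ), IsOffDiagonal F → S₁ n (translateMulti a F) = S₁ n F) ∧ (∀ (R : E ≃ₗᵢ[ℝ] E), LinearMap.det (R.toLinearEquiv : E →ₗ[ℝ] E) = 1 → (∀ i : Fin 4, ∃ j : Fin 4, R (EuclideanSpace.single i 1) = EuclideanSpace.single j 1 ∨ R (EuclideanSpace.single i 1) = -EuclideanSpace.single j 1) → ∀ (n : ℕ) (F : SchwartzMap (Fin n → E) ℂ), IsOffDiagonal F → S₁ n (linActMulti R F) = S₁ n F) ∧ (∃ Δ : ℝ, 0 < Δ ∧ S₁.toLabelled.HasMassGap Δ ∧ HasLatticeMassGap r sch Δ)); ∀ (r : LatticeRep G) (sch : SpeciesScheme (YMSpecies G)) (S₁ : SchwingerFamily E), W₁ r sch S₁ →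
      (∀ (f g : SchwartzMap E ℝ) (F : SchwartzMap (Fin 2 → E) ℂ) (F₁ G₁ : SchwartzMap (Fin 1 → E) ℂ), IsTensorOf F ![ofRealTest f, ofRealTest g] → IsOffDiagonal F → IsTensorOf F₁ ![ofRealTest f] → IsTensorOf G₁ ![ofRealTest g] → S₁ 2 F = S₁ 1 F₁ * S₁ 1 G₁) →
      ∃ (K : E → ℝ) (C η : ℝ), 0 < η ∧ ContinuousOn K {x : E | x ≠ 0} ∧ (∀ x : E, x ≠ 0 → |K x| ≤ C * (1 + ‖x‖ ^ (η - 10))) ∧ ∀ F : SchwartzMap (Fin 2 → E) ℂ, IsOffDiagonal F → MeasureTheory.Integrable (fun x : Fin 2 → E => (K (x 0 - x 1) : ℂ) * F x) ∧ S₁ 2 F = ∫ x : Fin 2 → E, (K (x 0 - x 1) : ℂ) * F x := by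
  sorry

/-- **stub_uvWindowMajorant** (U) — OPEN: THE RESIDUAL CRUX OF THE LINE (hardest stub; open-problem class =
"Bałaban with one observable", in the weakest currency this line could find). In the non-degenerate branch
with `|β_k| → ∞`: there are `η > 0` and physical floors `ρ_k → 0` such that for every FINITE family `𝓕` of
gauge-invariant local lattice observables there is `C` with, for all large `k`,
 (+) if `0 ≤ β_k`: for all `A, B ∈ 𝓕` and all separations `n` with `ρ_k ≤ a_k n` and `n ≤ L_k`,
     `c_k² · |latticeConnectedCorr r.ρ β_k (2L_k+1) A B n| ≤ C (1 + (a_k n)^(η-10))` — an AXIAL statement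
     in the curvature normalisation `c_k = sch.c r.curvature k` (the line's collapse to the time axis;
     `stub_latticeAxisDomination` turns it into the all-direction bound);
 (−) if `β_k < 0`: the all-direction bound for the curvature correlator itself at `‖z‖_∞ = n` (no lattice
     RP is available at negative coupling on the odd torus; non-degenerate negative-coupling schemes exist,
     conjecturally, only for `-1 ∈ ρ(Z(G))` via the centre-flux mirror `U ↦ uU`, where (−) is (+) ∘ RP on
     the fully twisted torus — stated outright so the stub stays sign-honest).
Content of (+), i.e. what a proof must deliver (asymptotically free window, β_k → +∞ on this subsequence):
 (a) WINDOW: for `ρ_k/a_k ≤ n ≤ ε/a_k`, leading-order lattice PT for ONE pair of gauge-invariant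
     correlators certified to FACTOR accuracy, uniformly over ≤ log₂(ε/ρ_k) RG scales all inside the
     small-running-coupling regime: every non-identity operator in any `A ∈ YMSpecies` has dimension ≥ 4
     (tr F², θ_μν, εFF̃; next 6: LuscherWeisz1985), so `c_k² ⟨A;B⟩(n) ≲ (a_k n)⁻⁸ · (ḡ-ratio)⁴ · (1+logs)`
     and ANY `η < 2` has a factor `(a_k n)^(η-2)` of slack per pair (KataevKrasnikovPivovarov 1982, NSVZ 1981
     for the expected shape; Balaban1988Convergent / Balaban1989LargeFieldII / Dimock 2013 for the tool);
 (b) CALIBRATION at ONE physical scale `ε`: `c_k² ⟨A;A⟩(⌊ε/a_k⌋) ≤ C_A` — for `A = P` from W₁'s convergence on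
     one separated real tensor pair plus a transverse no-spike/Harnack step at scale `ε` (triage G3/F4: RP
     never bounds axial values by smeared ones; this is where a lattice needle must be excluded), for the
     other members of `𝓕` by (a)-type comparison with `P`;
 (c) IR, `ε/a_k ≤ n ≤ L_k`: free from (b) — `c_k²⟨A;A⟩(n)` is non-increasing in `n ≤ L_k` (positive transfer
     matrix, `0 ≤ β_k`) and `|⟨A;B⟩| ≤ (⟨A;A⟩⟨B;B⟩)^½` (XiCompleteMonotonicity.AxialLogConvexity pattern).
 `ρ_k` exists to discard lattice artefacts (`n ≤ n₀`, shared links) and is what makes the statement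
 G2-proof: at FIXED lattice distance no k-uniform bound with the scheme's `c_k` can hold (triage r1-1 G2).
Why it might fail: (a) is an unbuilt theorem (UVStabilityNonUniqueness scope: effective actions, not
expectations, are what Bałaban's programme controls); a Wilson limit in which tr F² acquired window
dimension ≥ 5 − η/2, or lattice needles at scale ε surviving smeared convergence, violate it; the (−)
clause additionally bets on b.c.-insensitivity of twisted tori. Cheapest falsifier: effective doubling
exponent −log₂(G(2n)/G(n)) ≥ 10 for the axial plaquette–plaquette correlator at any weak-coupling scale
(published SU(2)/SU(3) 0⁺⁺ correlator data; kit j006523 LO numbers: exponent 8, transverse ratio (1+3κ²)⁻⁴).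
Leans on: `latticeConnectedCorr`, `HasLatticeMassGap`, `SpeciesScheme`, `wilsonMeasure`, `torusLift`,
`configShift`, `LatticeRep.curvature`; XiCompleteMonotonicity.`AxialLogConvexity` (support 8940),
`ExponentialWindow` (8936, the nearest typed UV statement — an ABSOLUTE lower bound, insufficient here). -/
theorem stub_uvWindowMajorant :
    let E := EuclideanSpace ℝ (Fin 4); ∀ (G : Type) [Group G] [TopologicalSpace G] [IsTopologicalGroup G] [CompactSpace G], IsCompactSimpleLieGroup G → letI : MeasurableSpace G := borel G; haveI : BorelSpace G := ⟨rfl⟩; let W₁ := fun (r : LatticeRep G) (sch : SpeciesScheme (YMSpecies G)) (S₁ : SchwingerFamily E) => ((∀ (n : ℕ), n ≠ 0 → ∀ (f : Fin n → SchwartzMap (E) ℝ) (F : SchwartzMap (Fin n → E) ℂ), IsTensorOf F (fun i => ofRealTest (f i)) → IsOffDiagonal F → Filter.Tendsto (fun k : ℕ => ((latticeSchwinger r.ρ sch (fun s => s.F) k n (fun _ => r.curvature) f : ℝ) : ℂ)) Filter.atTop (nhds (S₁ n F))) ∧ (S₁.toLabelled.IsNormalized ∧ S₁.toLabelled.IsHermitian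 ∧ S₁.toLabelled.HasLinearGrowth ∧ S₁.toLabelled.IsReflectionPositive ∧ S₁.toLabelled.IsSymmetric ∧ S₁.toLabelled.HasClusterProperty) ∧ (∀ (n : ℕ) (a : E) (F : SchwartzMap (Fin n → E) ℂ), IsOffDiagonal F → S₁ n (translateMulti a F) = S₁ n F) ∧ (∀ (R : E ≃ₗᵢ[ℝ] E), LinearMap.det (R.toLinearEquiv : E →ₗ[ℝ] E) = 1 → (∀ i : Fin 4, ∃ j : Fin 4, R (EuclideanSpace.single i 1) = EuclideanSpace.single j 1 ∨ R (EuclideanSpace.single i 1) = -EuclideanSpace.single j 1) → ∀ (n : ℕ) (F : SchwartzMap (Fin n → E) ℂ), IsOffDiagonal F → S₁ n (linActMulti R F) = S₁ n F) ∧ (∃ Δ : ℝ, 0 < Δ ∧ S₁.toLabelled.HasMassGap Δ ∧ HasLatticeMassGap r sch Δ)); ∀ (r : LatticeRep G) (sch : SpeciesScheme (YMSpecies G)) (S₁ : SchwingerFamily E), W₁ r sch S₁ →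
      ¬ (∀ (f g : SchwartzMap E ℝ) (F : SchwartzMap (Fin 2 → E) ℂ) (F₁ G₁ : SchwartzMap (Fin 1 → E) ℂ), IsTensorOf F ![ofRealTest f, ofRealTest g] → IsOffDiagonal F → IsTensorOf F₁ ![ofRealTest f] → IsTensorOf G₁ ![ofRealTest g] → S₁ 2 F = S₁ 1 F₁ * S₁ 1 G₁) →
      Filter.Tendsto (fun k : ℕ => |sch.β k|) Filter.atTop Filter.atTop →
      ∃ η : ℝ, 0 < η ∧ ∃ ρ : ℕ → ℝ, Filter.Tendsto ρ Filter.atTop (nhds 0) ∧ ∀ 𝓕 : Finset (YMSpecies G), ∃ C : ℝ, ∀ᶠ k in Filter.atTop,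
        (0 ≤ sch.β k → ∀ A ∈ 𝓕, ∀ B ∈ 𝓕, ∀ n : ℕ, 0 < n → ρ k ≤ sch.a k * n → n ≤ sch.L k → (sch.c r.curvature k) ^ 2 * |latticeConnectedCorr r.ρ (sch.β k) (2 * sch.L k + 1) A.F B.F n| ≤ C * (1 + (sch.a k * n) ^ (η - 10))) ∧
        (sch.β k < 0 → ∀ (n : ℕ) (z : Fin 4 → ℤ), 0 < n → ρ k ≤ sch.a k * n → n ≤ sch.L k → (∀ i : Fin 4, (z i).natAbs ≤ n) → (∃ i : Fin 4, (z i).natAbs = n) → (sch.c r.curvature k) ^ 2 * |(∫ U, r.curvature.F (torusLift (2 * sch.L k + 1) U) * r.curvature.F (configShift (-z) (torusLift (2 * sch.L k + 1) U)) ∂(wilsonMeasure (d := 4) (L := 2 * sch.L k + 1) r.ρ (sch.β k))) - (∫ U, r.curvature.F (torusLift (2 * sch.L k + 1) U) ∂(wilsonMeasure (d := 4) (L := 2 * sch.L k + 1) r.ρ (sch.β k))) * (∫ U, r.curvature.F (torusLift (2 * sch.L k + 1) U) ∂(wilsonMeasure (d := 4) (L := 2 * sch.L k + 1) r.ρ (sch.β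 k)))| ≤ C * (1 + (sch.a k * n) ^ (η - 10))) := by
  sorry

/-- **stub_latticeAxisDomination** (D) — PROVABLE NOW (size M/L): the lattice half of the lever, pure
reflection positivity of Wilson's action on the ODD torus of side `2L+1` at `β ≥ 0`. For every `G`, `r`
there is a FINITE family `𝓕 = 𝓕(r)` of gauge-invariant local observables (the action density `P`, its
≤ 2⁴ mirror-corner variants `P^(μ,±)` — reflection in `x_μ` of the unit hypercube keeps the three plaquettes
containing `e_μ` and moves the three others by `e_μ` — and their images under the lattice rotations taking
`e_μ` to `e₀`) such that for every `0 ≤ β`, `L`, every shift `z ≠ 0` in the fundamental domain with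
`n = ‖z‖_∞ ≤ L`, the connected curvature correlator at `z` is dominated by ONE axial correlator of the family
at time separation exactly `n`: `|⟨P₀ ; P_z⟩| ≤ |latticeConnectedCorr r.ρ β (2L+1) A B n|`, `A, B ∈ 𝓕`.
Proof plan: pick `μ` with `|z_μ| = n` (w.l.o.g. `z_μ = n > 0` by `⟨P₀;P_{-z}⟩ = ⟨P_z;P₀⟩`); reflect in the
hyperplane `x_μ = (n+1)/2` (a site plane if `n` is odd, a link plane if `n` is even; on the odd torus its
antipode `(n+1)/2 + L + ½` is of the other type — exactly the mixed reflection of `TorusOddRP`, RP for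
`0 ≤ β`, `Fact (1 < 2L+1)` from `1 ≤ n ≤ L`); `P₀` lives in the slab `[0,1] ⊆ [n/2 − L, (n+1)/2]` and `P_z`
in `[n, n+1] ⊆ [(n+1)/2, n/2 + L + 1]` (uses `1 ≤ n ≤ L`); with `B₁ := θ P₀` the 2×2 Cauchy–Schwarz of
the positive semi-definite connected OS form gives `⟨P₀;P_z⟩² = ⟨θB₁;P_z⟩² ≤ ⟨θB₁;B₁⟩ ⟨θP_z;P_z⟩`, and both
factors are axial correlators in direction `μ` at separation `n` between `P` and a mirror-corner variant
(transverse translation invariance of `wilsonMeasure`), turned into direction `e₀` by a signed permutation of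
the symmetric torus (invariance of the Wilson action and of product Haar); so `|⟨P₀;P_z⟩| ≤ max` of the two,
each of the form `|latticeConnectedCorr … A.F B.F n|`. At `β = 0` both sides vanish for `z ≠ 0`
(cdisprove §4). Continuum shadow: `AxisDomination` of the idea card (`|K ξ| ≤ K(|ξ_μ| e₀)`).
Leans on: `TorusOddRP` (`StringTension.*_odd`, `LatticeRP.re_sum_pair_sq_le`,
`integral_mul_conj_mul_exp_nonneg_of_shared`), `TorusSiteRP`, `wilsonMeasure`, `torusLift`, `configShift`,
`plaquetteObs`, `LocalGaugeObservable` (to package the variants as `YMSpecies`). -/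
theorem stub_latticeAxisDomination :
    ∀ (G : Type) [Group G] [TopologicalSpace G] [IsTopologicalGroup G] [CompactSpace G], letI : MeasurableSpace G := borel G; haveI : BorelSpace G := ⟨rfl⟩; ∀ (r : LatticeRep G), ∃ 𝓕 : Finset (YMSpecies G), ∀ (β : ℝ), 0 ≤ β → ∀ (L n : ℕ) (z : Fin 4 → ℤ), 0 < n → n ≤ L → (∀ i : Fin 4, (z i).natAbs ≤ n) → (∃ i : Fin 4, (z i).natAbs = n) → ∃ A ∈ 𝓕, ∃ B ∈ 𝓕, |(∫ U, r.curvature.F (torusLift (2 * L + 1) U) * r.curvature.F (configShift (-z) (torusLift (2 * L + 1) U)) ∂(wilsonMeasure (d := 4) (L := 2 * L + 1) r.ρ β)) - (∫ U, r.curvature.F (torusLift (2 * L + 1) U) ∂(wilsonMeasure (d := 4) (L := 2 * L + 1) r.ρ β)) * (∫ U, r.curvature.F (torusLift (2 * L + 1) U) ∂(wilsonMeasure (d := 4) (L := 2 * L + 1) r.ρ β))| ≤ |latticeConnectedCorr r.ρ β (2 * L + 1) A.F B.F n| := by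
  sorry

/-- **stub_dominatedLatticeKernel** (L) — PROVABLE NOW (size L): from k-uniformly dominated lattice kernels
to a measurable bounded representing kernel ("EnvelopeToKernel + identification"). If, eventually in `k`,
the renormalised connected curvature correlator obeys `c_k² |⟨P₀;P_z⟩_k| ≤ C (1 + (a_k ‖z‖_∞)^(η-10))` for
all shifts in the fundamental domain at physical sup-distance `≥ ρ_k → 0`, then there is a MEASURABLE real
`K` with `|K x| ≤ C' (1 + ‖x‖^(η-10))` off 0 representing `S₁ 2` on `⁰𝒮` (the crux's conclusion with
continuity replaced by measurability). Proof plan: (1) expand `latticeSchwinger … 2` of a real tensor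
`f₀ ⊗ f₁`: `c_k² a_k⁸ Σ_{x,y ∈ box} f₀(a_k x) f₁(a_k y) [⟨P₀;P_{y-x}⟩_k + (⟨P⟩_k − m_k)²]` (torus translation
invariance of `wilsonMeasure` under `configShift ∘ torusLift`), and `c_k a_k⁴ (⟨P⟩_k − m_k) Σ f → S₁ 1` gives
the constant `s` (W₁ clause 1, `n = 1`); (2) the step kernels `K_k(ξ) := c_k² ⟨P₀;P_{[ξ/a_k]}⟩_k` are bounded
on `{δ ≤ |ξ| ≤ R}` uniformly for `k ≥ k(δ,R)` (`ρ_k < δ/2`, `R/a_k ≤ L_k` by `a_k L_k → ∞`), so along a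
diagonal subsequence `K_k ⇀* K_c` in `L^∞_loc(ℝ⁴∖0)`; `K := K_c + s²`, measurable, `|K| ≤ 2^(10-η) C + s²`
-type bound a.e. (`‖ξ‖_∞ ≥ ‖ξ‖₂/2`), modified on a null set to hold everywhere; (3) for COMPACTLY supported
real `f₀, f₁` with DISJOINT supports neither short pairs (`|ξ| < ρ_k`) nor wrap-around pairs occur for large
`k`, the Riemann sums converge to `∫∫ f₀ f₁ K` along the subsequence, and to `S₁ 2 (f₀⊗f₁)` along the full
sequence (W₁), so they agree; (4) both `S₁ 2` and `F ↦ ∫ K(x₀−x₁) F` are continuous on `⁰𝒮(E²)` (the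
latter by `|F(x₀,x₁)| ≤ p_N(F) |x₀−x₁|^N (1+|x|)^(-M)`, `N ≥ 10`, Taylor flatness on the diagonal — this also
gives `Integrable`), and disjointly supported real tensors span a dense subspace of `⁰𝒮` (as in
`stub_degenerateKernel` (c)), so the representation holds on all of `⁰𝒮`. No control of `c_k` is needed.
Leans on: `latticeSchwinger`, `smearedLatticeField`, `box`, `siteToE`, `wilsonMeasure`, `torusLift`,
`configShift`, `SchwartzTensorDensity`, `IsOffDiagonal.of_tsupport_subset`, Banach–Alaoglu in `L^∞`
(Mathlib `WeakDual`), cdisprove §5 `kernel_unique` (uniqueness of the outcome, by name). -/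
theorem stub_dominatedLatticeKernel :
    let E := EuclideanSpace ℝ (Fin 4); ∀ (G : Type) [Group G] [TopologicalSpace G] [IsTopologicalGroup G] [CompactSpace G], IsCompactSimpleLieGroup G → letI : MeasurableSpace G := borel G; haveI : BorelSpace G := ⟨rfl⟩; let W₁ := fun (r : LatticeRep G) (sch : SpeciesScheme (YMSpecies G)) (S₁ : SchwingerFamily E) => ((∀ (n : ℕ), n ≠ 0 → ∀ (f : Fin n → SchwartzMap (E) ℝ) (F : SchwartzMap (Fin n → E) ℂ), IsTensorOf F (fun i => ofRealTest (f i)) → IsOffDiagonal F → Filter.Tendsto (fun k : ℕ => ((latticeSchwinger r.ρ sch (fun s => s.F) k n (fun _ => r.curvature) f : ℝ) : ℂ)) Filter.atTop (nhds (S₁ n F))) ∧ (S₁.toLabelled.IsNormalized ∧ S₁.toLabelled.IsHermitian ∧ S₁.toLabelled.HasLinearGrowth ∧ S₁.toLabelled.IsReflectionPositive ∧ S₁.toLabelled.IsSymmetric ∧ S₁.toLabelled.HasClusterProperty) ∧ (∀ (n : ℕ) (a : E) (F : SchwartzMap (Fin n → E) ℂ), IsOffDiagonal F → S₁ n (translateMulti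 a F) = S₁ n F) ∧ (∀ (R : E ≃ₗᵢ[ℝ] E), LinearMap.det (R.toLinearEquiv : E →ₗ[ℝ] E) = 1 → (∀ i : Fin 4, ∃ j : Fin 4, R (EuclideanSpace.single i 1) = EuclideanSpace.single j 1 ∨ R (EuclideanSpace.single i 1) = -EuclideanSpace.single j 1) → ∀ (n : ℕ) (F : SchwartzMap (Fin n → E) ℂ), IsOffDiagonal F → S₁ n (linActMulti R F) = S₁ n F) ∧ (∃ Δ : ℝ, 0 < Δ ∧ S₁.toLabelled.HasMassGap Δ ∧ HasLatticeMassGap r sch Δ)); ∀ (r : LatticeRep G) (sch : SpeciesScheme (YMSpecies G)) (S₁ : SchwingerFamily E), W₁ r sch S₁ →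
      (∃ η : ℝ, 0 < η ∧ ∃ ρ : ℕ → ℝ, Filter.Tendsto ρ Filter.atTop (nhds 0) ∧ ∃ C : ℝ, ∀ᶠ k in Filter.atTop, ∀ (n : ℕ) (z : Fin 4 → ℤ), 0 < n → ρ k ≤ sch.a k * n → n ≤ sch.L k → (∀ i : Fin 4, (z i).natAbs ≤ n) → (∃ i : Fin 4, (z i).natAbs = n) → (sch.c r.curvature k) ^ 2 * |(∫ U, r.curvature.F (torusLift (2 * sch.L k + 1) U) * r.curvature.F (configShift (-z) (torusLift (2 * sch.L k + 1) U)) ∂(wilsonMeasure (d := 4) (L := 2 * sch.L k + 1) r.ρ (sch.β k))) - (∫ U, r.curvature.F (torusLift (2 * sch.L k + 1) U) ∂(wilsonMeasure (d := 4) (L := 2 * sch.L k + 1) r.ρ (sch.β k))) * (∫ U, r.curvature.F (torusLift (2 * sch.L k + 1) U) ∂(wilsonMeasure (d := 4) (L := 2 * sch.L k + 1) r.ρ (sch.β k)))| ≤ C * (1 + (sch.a k * n) ^ (η - 10))) →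
      ∃ (K : E → ℝ) (C η : ℝ), 0 < η ∧ Measurable K ∧ (∀ x : E, x ≠ 0 → |K x| ≤ C * (1 + ‖x‖ ^ (η - 10))) ∧ ∀ F : SchwartzMap (Fin 2 → E) ℂ, IsOffDiagonal F → MeasureTheory.Integrable (fun x : Fin 2 → E => (K (x 0 - x 1) : ℂ) * F x) ∧ S₁ 2 F = ∫ x : Fin 2 → E, (K (x 0 - x 1) : ℂ) * F x := by
  sorry

/-- **stub_axisChartContinuity** (C) — MODEL-BLIND REGULARITY HALF, PROVABLE NOW (size L): "a two-point
kernel of an RP theory is a continuous FUNCTION off 0 iff its axial values are finite" (idea card item 1),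
in the form the composition needs. For ANY one-species family `S₁` on `ℝ⁴` with E2 (`IsReflectionPositive`),
translation invariance on `⁰𝒮` and invariance under the PROPER signed permutations on `⁰𝒮` (all three are
clauses of W₁; no rotations, no diagonal mirrors, no lattice): if `S₁ 2` is represented on `⁰𝒮` by a REAL,
MEASURABLE kernel `K(x₀ − x₁)` obeying `|K x| ≤ C (1 + ‖x‖^(η-10))` off 0, then it is represented by a
kernel CONTINUOUS on `ℝ⁴ ∖ 0` with the same bound (namely the continuous representative of `K`).
Proof plan: (1) E2 with one degree-1 term, `F` supported in `{x₀ > 0}` (time-ordered; `osAdjoint F ⊗ F` is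
off-diagonal since `θx ≠ y` there): `∫∫ K(θx − y) conj F(x) F(y) ≥ 0`, i.e. `k(s, ζ⃗) := K(−s, ζ⃗)` is
reflection-positive-definite on the open half-space in the integrated sense; (2) OS reconstruction WITHOUT
E1 (tree `OSReconstructionNoE1`: `h.transfer t = e^{-tH}`, `h.translate a⃗`, and the PROVED
`exists_isJointSpectralMeasure_holds`): `⟪Ψ_F, e^{-tH} U(a⃗) Ψ_F⟫ = ∫ e^{-t p₀ + i a⃗·p⃗} dμ_F(p)` with `μ_F`
finite, `p₀ ≥ 0`; letting `F` shrink to a point `(s/2, 0⃗)` and using LOCAL BOUNDEDNESS of `K` near the axis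
point (Bochner–Schwartz: a positive measure whose Fourier transform is `L^∞` near 0 is finite — Fatou against
`ψ_ε = φ_ε ∗ φ̃_ε`) gives `k(s, ·) = ν̂_s` with `ν_s = e^{-s p₀} μ` FINITE, so `k(s,·)` is bounded continuous and,
by dominated convergence on `[s₁, ∞) × ℝ³` (`p₀ ≥ 0`; growth at most polynomial by the bound), `k` is jointly
continuous on `{s > 0}` — a.e. equal to `K` on the chart `{ξ₀ < 0}`; (3) the proper signed permutation `−I`
(det = +1 in dimension 4) gives the chart `{ξ₀ > 0}`, and the rotations `e_μ ↦ e₀, e₀ ↦ −e_μ` (det 1) give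
`{ξ_μ ≠ 0}`, `μ = 1,2,3` (invariance of `S₁ 2` on `⁰𝒮` ⇒ `K ∘ R = K` a.e.); the four charts cover `ℝ⁴ ∖ 0`
and continuous representatives agree on (open) overlaps, giving `K'` continuous off 0 with `K' = K` a.e.;
(4) `∫ K' F = ∫ K F`, integrability is unchanged, and the bound passes from a.e. to everywhere because
`{x ≠ 0 | |K' x| > C(1+‖x‖^(η-10))}` is open and null. The needle Σ_μ δ³(x⊥_μ) e^{-m|x_μ|} (rattack App. C)
shows the local-boundedness hypothesis cannot be dropped. Continuum `AxisDomination` (card lever A) is the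
pointwise corollary `|K' ξ| ≤ K'(|ξ_μ| e₀)` once `K'` is continuous; it rides as a `--supports` lemma.
Leans on: `OSReconstructionNoE1` (+ `of_osAxioms`-style construction from the two clauses),
`IsJointSpectralMeasure`, `exists_isJointSpectralMeasure_holds`, `inner_fieldVec_fieldVec`, `timeReflection`,
`linActMulti`, `translateMulti`, Mathlib Bochner (`MeasureTheory.Measure` Fourier transform) and
`MeasureTheory.ae` modification lemmas; Neeb–Ólafsson arXiv:1802.09037 §§3–4, OS 1973 §4, GJ Thm 6.2.x. -/
theorem stub_axisChartContinuity :
    let E := EuclideanSpace ℝ (Fin 4); ∀ (S₁ : SchwingerFamily E), S₁.toLabelled.IsReflectionPositive →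
      (∀ (n : ℕ) (a : E) (F : SchwartzMap (Fin n → E) ℂ), IsOffDiagonal F → S₁ n (translateMulti a F) = S₁ n F) →
      (∀ (R : E ≃ₗᵢ[ℝ] E), LinearMap.det (R.toLinearEquiv : E →ₗ[ℝ] E) = 1 → (∀ i : Fin 4, ∃ j : Fin 4, R (EuclideanSpace.single i 1) = EuclideanSpace.single j 1 ∨ R (EuclideanSpace.single i 1) = -EuclideanSpace.single j 1) → ∀ (n : ℕ) (F : SchwartzMap (Fin n → E) ℂ), IsOffDiagonal F → S₁ n (linActMulti R F) = S₁ n F) →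
      (∃ (K : E → ℝ) (C η : ℝ), 0 < η ∧ Measurable K ∧ (∀ x : E, x ≠ 0 → |K x| ≤ C * (1 + ‖x‖ ^ (η - 10))) ∧ ∀ F : SchwartzMap (Fin 2 → E) ℂ, IsOffDiagonal F → MeasureTheory.Integrable (fun x : Fin 2 → E => (K (x 0 - x 1) : ℂ) * F x) ∧ S₁ 2 F = ∫ x : Fin 2 → E, (K (x 0 - x 1) : ℂ) * F x) →
      ∃ (K : E → ℝ) (C η : ℝ), 0 < η ∧ ContinuousOn K {x : E | x ≠ 0} ∧ (∀ x : E, x ≠ 0 → |K x| ≤ C * (1 + ‖x‖ ^ (η - 10))) ∧ ∀ F : SchwartzMap (Fin 2 → E) ℂ, IsOffDiagonal F → MeasureTheory.Integrable (fun x : Fin 2 → E => (K (x 0 - x 1) : ℂ) * F x) ∧ S₁ 2 F = ∫ x : Fin 2 → E, (K (x 0 - x 1) : ℂ) * F x := by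
  sorry

/-! ## The composition (sorry-free) -/

/-- **`CurvatureKernelBound_of`** — the six stub STATEMENTS imply the crux, by name. Pure logic plus one
`calc`: excluded middle on Degenerate; in the non-degenerate branch the dichotomy gives `|β_k| → ∞`, the
UV stub gives `η, ρ, C` for the finite family `𝓕(r)` of the domination stub, and for each large `k` either
`0 ≤ β_k` (domination ∘ axial majorant, `c_k² ≥ 0`) or `β_k < 0` (the all-direction clause) yields the
hypothesis of the kernel-limit stub; its measurable kernel is made continuous by the chart stub, fed with
W₁'s E2 / translation / proper-hypercubic clauses. -/
theorem CurvatureKernelBound_of :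
    type_of% stub_schemeDichotomy → type_of% stub_degenerateKernel → type_of% stub_uvWindowMajorant →
    type_of% stub_latticeAxisDomination → type_of% stub_dominatedLatticeKernel →
    type_of% stub_axisChartContinuity →
    Summit.QuantumFields.YangMills.Theses.PencilRigidity.CurvatureKernelBound := by
  intro hT hZ hU hD hL hC G i1 i2 i3 i4 hG
  letI : MeasurableSpace G := borel G
  haveI : BorelSpace G := ⟨rfl⟩
  intro W₁ r sch S₁ hW
  -- the S₁-side clauses of W₁ used by the continuity stub (E2, translations, proper W(B₄))
  obtain ⟨-, ⟨-, -, -, hrp, -, -⟩, htr, hhyp, -⟩ := id hW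
  -- case split on the degenerate (ultralocal) branch; the proposition is read off `hZ`
  refine (Classical.em _).elim (fun hdeg => hZ G hG r sch S₁ hW hdeg) (fun hdeg => ?_)
  -- non-degenerate branch: |β_k| → ∞ (scheme dichotomy), then the UV window majorant
  have hβ : Filter.Tendsto (fun k : ℕ => |sch.β k|) Filter.atTop Filter.atTop :=
    (hT G hG r sch S₁ hW).resolve_left hdeg
  obtain ⟨η, hη, ρ, hρ, hU'⟩ := hU G hG r sch S₁ hW hdeg hβ
  -- lattice reflection positivity: off-axis correlators dominated by axial ones (finite family 𝓕)
  obtain ⟨𝓕, hD'⟩ := hD G r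
  obtain ⟨C, hCev⟩ := hU' 𝓕
  -- all-direction domination of the renormalised lattice kernel at physical scales ≥ ρ_k, for every
  -- large k: if 0 ≤ β_k, the dominating axial pair (A, B) ∈ 𝓕 × 𝓕 obeys the window majorant with the
  -- curvature's c_k (c_k² ≥ 0); if β_k < 0, the UV stub's second clause is the bound itself
  obtain ⟨K, C', η', hη', hKm, hKb, hKr⟩ := hL G hG r sch S₁ hW ⟨η, hη, ρ, hρ, C, by
    filter_upwards [hCev] with k hk
    intro n z hn hρn hnL hzle hzeq
    rcases le_or_gt 0 (sch.β k) with hβk | hβk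
    · obtain ⟨A, hA, B, hB, hle⟩ := hD' (sch.β k) hβk (sch.L k) n z hn hnL hzle hzeq
      exact le_trans (mul_le_mul_of_nonneg_left hle (sq_nonneg _)) (hk.1 hβk A hA B hB n hn hρn hnL)
    · exact hk.2 hβk n z hn hρn hnL hzle hzeq⟩
  -- regularity half: a measurable, locally bounded representing kernel is continuous off 0
  exact hC S₁ hrp htr hhyp ⟨K, C', η', hη', hKm, hKb, hKr⟩

/-- The crux along this line, MODULO the six registered stubs (references every `stub_*`, so the audit
shows exactly which sorries the crux still depends on; a lead closes the crux by discharging them). -/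
theorem CurvatureKernelBound_of_stubs :
    Summit.QuantumFields.YangMills.Theses.PencilRigidity.CurvatureKernelBound :=
  CurvatureKernelBound_of stub_schemeDichotomy stub_degenerateKernel stub_uvWindowMajorant
    stub_latticeAxisDomination stub_dominatedLatticeKernel stub_axisChartContinuity

end Summit.QuantumFields.YangMills.Cruxes.CurvatureKernelBound.AxisExtremalCollapse
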